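import Literature.NumberTheory.LFunctions.KloostermanFractionsDiagonal
import Literature.NumberTheory.LFunctions.KloostermanFractionsAmplifiedForm
import Literature.NumberTheory.Sieve.DivisorBound
import HarnessLib

/-!
# Bilinear forms with Kloosterman fractions: tools for the passage (2.2)+(3.2)+(4.33) ⟹ (5.1)

Topic `NumberTheory/LFunctions`.  S. Bettin, V. Chandee, *Trilinear forms with Kloosterman
fractions*, Adv. Math. 328 (2018), §§2, 3, 5 (with `A = 1`, `ϑ = k`).  In §5 the source combines
the amplified inequality (2.2), `𝓒_b ≪ M L^{-2+ε} 𝓓_b` (valid "provided that `L > 2 log(bϑM)`",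
§2), with the diagonal bound (3.2), `𝒟_b ≪ ‖β‖² L ((bLN)^{1/2} + M/(bN) + M) M^ε`, and the
off-diagonal bound (4.33) to obtain (5.1).  This file PROVES the explicit ingredients of that
passage for the second moment over `m ∼ M` (`∑_{M<m≤2M,(m,b)=1} |kfInner k b N' γ m|²`):

* `BC_card_amplifier_ge` — with `𝓛 = {ℓ ∈ (L, 2L] prime, (ℓ, bk) = 1}` and `log(b|k|m) ≤ L/4`,
  `#{ℓ ∈ 𝓛 : (ℓ, m) = 1} ≥ L/(4 log L)` (from `DFI_card_primes_Ioc_ge`,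
  `DFI_card_primes_dvd_mul_log_le` of `KloostermanFractionsAmplifier.lean`);
* `BC_diag_51` — the diagonal bound `kfd_diag_bound` (`KloostermanFractionsDiagonal.lean`, with the
  divisor bound `τ(n) ≤ C₁ n^δ`) multiplied by the amplifier factor `32 M (log L)²/L²`, in the shape
  of the first three terms of (5.1): `≪ ‖γ‖² x^{6δ} (M(bN')^{1/2}L^{-1/2} + M²/(bLN') + M²/L)`,
  `x = bMN'(1+|k|)`, with an explicit constant;
* `BC_off_51` — the same multiplication for a bound of the shape (4.33), giving the last three
  terms of (5.1) (`b^{3/4}M^{1/2}N'^{5/4}L^{-1/2} + b^{1/2}L^{3/2}N'^{7/4} + b^{1/2}MN'/L`);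
* `BC_terms51_floor_le`, `BC_MN_le_terms51`, `BC_bkm_le_two_x` — bookkeeping (`⌊L⌋` versus `L`,
  the trivial range `L > M`, and `b|k|m ≤ 2x`).

The assembly is `KloostermanFractionsFromOff.lean`.

## References

* S. Bettin, V. Chandee, Adv. Math. 328 (2018) 1234–1262 (arXiv:1502.00769), §2 ((2.2) and the
  remark on `L > 2 log(bϑM)`), §3 (3.2), §4 (4.33), §5 (5.1). [BettinChandee2018]
* W. Duke, J. Friedlander, H. Iwaniec, *Bilinear forms with Kloosterman fractions*, Invent. Math.
  128 (1997) 23–43, §§3–5. [DukeFriedlanderIwaniec1997]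
-/

noncomputable section

open Finset

namespace Literature.NumberTheory.LFunctions

/-! ### Small analytic lemmas -/

/-- `(log L)² ≤ L^{2δ}/δ²` for `L ≥ 1`, `δ > 0`. [folklore] -/
theorem BC_log_sq_le {δ L : ℝ} (hδ : 0 < δ) (hL : 1 ≤ L) :
    Real.log L ^ 2 ≤ L ^ (2 * δ) / δ ^ 2 := by
  have h1 : Real.log L ≤ L ^ δ / δ := Real.log_le_rpow_div (by linarith) hδ
  have h0 : 0 ≤ Real.log L := Real.log_nonneg hL
  have h2 : Real.log L ^ 2 ≤ (L ^ δ / δ) ^ 2 := pow_le_pow_left₀ h0 h1 2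
  calc Real.log L ^ 2 ≤ (L ^ δ / δ) ^ 2 := h2
    _ = L ^ (2 * δ) / δ ^ 2 := by
        rw [div_pow, ← Real.rpow_natCast (L ^ δ) 2, ← Real.rpow_mul (by linarith)]
        norm_num [mul_comm]

/-- `1 + log y ≤ (1 + 1/δ) y^δ` for `y ≥ 1`, `δ > 0`. [folklore] -/
theorem BC_one_add_log_le {δ y : ℝ} (hδ : 0 < δ) (hy : 1 ≤ y) :
    1 + Real.log y ≤ (1 + 1 / δ) * y ^ δ := by
  have h1 : Real.log y ≤ y ^ δ / δ := Real.log_le_rpow_div (by linarith) hδ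
  have h2 : (1 : ℝ) ≤ y ^ δ := Real.one_le_rpow hy hδ.le
  calc 1 + Real.log y ≤ y ^ δ + y ^ δ / δ := by linarith
    _ = (1 + 1 / δ) * y ^ δ := by ring

/-- `log y ≤ (1/δ) y^δ` and hence `log y / log L ≤ (2/δ) y^δ` for `L ≥ 2` (`log 2 > 1/2`).
[folklore] -/
theorem BC_log_div_log_le {δ y : ℝ} (hδ : 0 < δ) (hy : 1 ≤ y) {L : ℝ} (hL : 2 ≤ L) :
    Real.log y / Real.log L ≤ 2 / δ * y ^ δ := by
  have h1 : Real.log y ≤ y ^ δ / δ := Real.log_le_rpow_div (by linarith) hδ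
  have hlog2 : (1 / 2 : ℝ) < Real.log 2 := by
    have := Real.log_two_gt_d9; linarith
  have hlogL : Real.log 2 ≤ Real.log L := Real.log_le_log (by norm_num) hL
  have hlogL0 : 0 < Real.log L := by linarith
  have hy0 : 0 ≤ Real.log y := Real.log_nonneg hy
  have hyd : 0 ≤ y ^ δ := Real.rpow_nonneg (by linarith) δ
  rw [div_le_iff₀ hlogL0]
  calc Real.log y ≤ y ^ δ / δ := h1
    _ = y ^ δ / δ * 1 := by ring
    _ ≤ y ^ δ / δ * (2 * Real.log L) := by
        apply mul_le_mul_of_nonneg_left _ (by positivity)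
        linarith
    _ = 2 / δ * y ^ δ * Real.log L := by ring

/-- `⌊2M⌋₊ − ⌊M⌋₊ ≤ 3M` (as reals) for `M ≥ 1/2`. [folklore] -/
theorem BC_floor_diff_le {M : ℝ} (hM : 1 / 2 ≤ M) :
    ((⌊2 * M⌋₊ : ℕ) : ℝ) - ((⌊M⌋₊ : ℕ) : ℝ) ≤ 3 * M := by
  have h1 : ((⌊2 * M⌋₊ : ℕ) : ℝ) ≤ 2 * M := Nat.floor_le (by linarith)
  have h2 : M < ((⌊M⌋₊ : ℕ) : ℝ) + 1 := Nat.lt_floor_add_one M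
  linarith

/-! ### The amplifier: enough primes in `(L, 2L]` coprime to `b k m` -/

/-- **Lower bound for the number of amplifying primes coprime to `m`**: if `(L, 2L]` contains at
least `L/(2 log L)` primes and `log(b|k|m) ≤ L/4`, then at least `L/(4 log L)` primes
`ℓ ∈ (L, 2L]` are coprime to `b`, `k` and `m` (the primes `> L` dividing `b|k|m` number at most
`log(b|k|m)/log L`, `DFI_card_primes_dvd_mul_log_le`).  Bettin–Chandee §2: "If `L > 2 log(bϑM)`,
then `∑_{ℓ∈𝓛,(ℓ,ϑb)=1} χ₀(ℓ) ≫ L/log L`". [cite: BettinChandee2018, §2] -/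
theorem BC_card_amplifier_ge {L₀ L : ℕ}
    (hL₀ : ∀ L : ℕ, L₀ ≤ L →
      (L : ℝ) / (2 * Real.log L) ≤ (((Ioc L (2 * L)).filter Nat.Prime).card : ℝ))
    (hL : L₀ ≤ L) (hL2 : 2 ≤ L) {b m : ℕ} {k : ℤ} (hb : 0 < b) (hm : 0 < m) (hk : k ≠ 0)
    (hlog : Real.log ((b * k.natAbs * m : ℕ) : ℝ) ≤ (L : ℝ) / 4) :
    (L : ℝ) / (4 * Real.log L) ≤
      ((((Ioc L (2 * L)).filter (fun ℓ => ℓ.Prime ∧ ℓ.Coprime b ∧ ℓ.Coprime k.natAbs)).filter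
        (fun ℓ => ℓ.Coprime m)).card : ℝ) := by
  set P := (Ioc L (2 * L)).filter Nat.Prime with hP
  have hPprime : ∀ ℓ ∈ P, ℓ.Prime := fun ℓ hℓ => (Finset.mem_filter.mp hℓ).2
  have heq : ((Ioc L (2 * L)).filter (fun ℓ => ℓ.Prime ∧ ℓ.Coprime b ∧ ℓ.Coprime k.natAbs)).filter
        (fun ℓ => ℓ.Coprime m) = P.filter (fun ℓ => ℓ.Coprime (b * k.natAbs * m)) := by
    ext ℓ
    simp only [hP, Finset.mem_filter, Nat.coprime_mul_iff_right]
    tauto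
  rw [heq, DFI_card_filter_coprime_eq hPprime]
  have hsub : (P.filter (fun ℓ => ℓ ∣ b * k.natAbs * m)).card ≤ P.card :=
    Finset.card_filter_le _ _
  rw [Nat.cast_sub hsub]
  have hL1 : (1 : ℝ) < L := by exact_mod_cast (show 1 < L by omega)
  have hlogL : 0 < Real.log L := Real.log_pos hL1
  have h1 := hL₀ L hL
  have hprod : 0 < b * k.natAbs * m := by
    have : 0 < k.natAbs := Int.natAbs_pos.mpr hk
    positivity
  have h2 := DFI_card_primes_dvd_mul_log_le (𝓛 := P) (L := (L : ℝ)) hL1.le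
    (fun ℓ hℓ => ⟨hPprime ℓ hℓ, by
      have := (Finset.mem_Ioc.mp (Finset.mem_filter.mp hℓ).1).1
      exact_mod_cast this⟩) hprod
  have h3 : ((P.filter (fun ℓ => ℓ ∣ b * k.natAbs * m)).card : ℝ) ≤ (L : ℝ) / 4 / Real.log L := by
    rw [le_div_iff₀ hlogL]; exact h2.trans hlog
  have h4 : (L : ℝ) / (4 * Real.log L) =
      (L : ℝ) / (2 * Real.log L) - (L : ℝ) / 4 / Real.log L := by
    field_simp; ring
  rw [h4]; linarith

/-! ### The diagonal contribution in the shape (5.1) -/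

set_option maxHeartbeats 400000 in
/-- **The diagonal terms in the shape of (5.1)** (Bettin–Chandee (3.2) × the amplifier factor
`M L^{-2+ε}`): with the divisor bound `τ(n) ≤ C₁ n^δ`, `1 ≤ N'`, `1/2 ≤ M`, `2 ≤ L ≤ M`, `k ≠ 0`,
`(b, k) = 1`, `γ` supported on `n ∈ (N', 2N']` coprime to `k`, and
`𝓛 = {ℓ ∈ (L, 2L] prime, (ℓ, bk) = 1}`,
`(32 M (log L)²/L²) ‖∑_{M<m≤2M,(m,b)=1} kfDiag m‖ ≤ C S₂ x^{6δ} (M (bN')^{1/2} L^{-1/2} + M²/(bLN') + M²/L)`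
with `x = bMN'(1+|k|)`, `S₂ = ∑ |γ_n|²`, `C = 40000 C₁² (1 + 1/δ)/δ³` (`kfd_diag_bound`).
[cite: BettinChandee2018, §3 (3.2), §5 (5.1)] -/
theorem BC_diag_51 {δ : ℝ} (hδ : 0 < δ) (hδ1 : δ ≤ 1) {C₁ : ℝ} (hC₁ : 1 ≤ C₁)
    (hτ : ∀ n : ℕ, n ≠ 0 → ((n.divisors.card : ℕ) : ℝ) ≤ C₁ * (n : ℝ) ^ δ)
    {b : ℕ} (hb : 0 < b) {M N' : ℝ} (hM : 1 / 2 ≤ M) (hN1 : 1 ≤ N') {k : ℤ} (hk : k ≠ 0)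
    (hbk : b.Coprime k.natAbs) {γ : ℕ → ℂ} (hγ : ∀ n, γ n ≠ 0 → N' < n ∧ (n : ℝ) ≤ 2 * N')
    (hγk : ∀ n, γ n ≠ 0 → n.Coprime k.natAbs) {L : ℕ} (hL2 : 2 ≤ L) (hLM : (L : ℝ) ≤ M) :
    32 * M * Real.log L ^ 2 / (L : ℝ) ^ 2 *
      ‖∑ m ∈ (Ioc ⌊M⌋₊ ⌊2 * M⌋₊).filter (fun m => m.Coprime b),
          kfDiag k b N' γ ((Ioc L (2 * L)).filter
            (fun ℓ => ℓ.Prime ∧ ℓ.Coprime b ∧ ℓ.Coprime k.natAbs)) m‖ ≤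
      40000 * C₁ ^ 2 * (1 + 1 / δ) / δ ^ 3 * (∑ n ∈ Icc 1 ⌊2 * N'⌋₊, ‖γ n‖ ^ 2) *
        ((b : ℝ) * M * N' * (1 + |(k : ℝ)|)) ^ (6 * δ) *
        (M * ((b : ℝ) * N') ^ (1 / 2 : ℝ) * (L : ℝ) ^ (-(1 / 2) : ℝ) + M ^ 2 / ((b : ℝ) * L * N') +
          M ^ 2 / L) := by
  -- names
  set 𝓛 := (Ioc L (2 * L)).filter (fun ℓ => ℓ.Prime ∧ ℓ.Coprime b ∧ ℓ.Coprime k.natAbs) with h𝓛def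
  set S₂ : ℝ := ∑ n ∈ Icc 1 ⌊2 * N'⌋₊, ‖γ n‖ ^ 2 with hS₂
  set x : ℝ := (b : ℝ) * M * N' * (1 + |(k : ℝ)|) with hx
  have hS0 : 0 ≤ S₂ := Finset.sum_nonneg fun _ _ => sq_nonneg _
  have hbr : (1 : ℝ) ≤ b := by exact_mod_cast hb
  have hb0 : (0 : ℝ) < b := by linarith
  have hM0 : 0 < M := by linarith
  have hN0 : 0 < N' := by linarith
  have hk1 : (1 : ℝ) ≤ |(k : ℝ)| := by
    rw [← Int.cast_abs]; exact_mod_cast Int.one_le_abs hk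
  have hLr : (2 : ℝ) ≤ L := by exact_mod_cast hL2
  have hL0 : (0 : ℝ) < L := by linarith
  have hL1 : (1 : ℝ) ≤ L := by linarith
  -- `x ≥ 1`, `M ≤ x`, `2N' ≤ 2x`, `bLN' ≤ x`, `2bN' ≤ 2x`
  have hbN1 : (1 : ℝ) ≤ b * N' := by nlinarith
  have hMx : M ≤ x := by
    have : M * 1 * 2 ≤ M * ((b : ℝ) * N') * (1 + |(k : ℝ)|) := by gcongr; linarith
    rw [hx]; nlinarith
  have hx1 : 1 ≤ x := by
    have : (1 / 2 : ℝ) ≤ M := hM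
    have h2 : (1 : ℝ) * (1 / 2) * 2 ≤ ((b : ℝ) * N') * M * (1 + |(k : ℝ)|) := by gcongr; linarith
    rw [hx]; nlinarith
  have hx0 : 0 < x := by linarith
  have hN'x : 2 * N' ≤ 2 * x := by
    have : N' * 1 * (1 / 2) * 2 ≤ N' * (b : ℝ) * M * (1 + |(k : ℝ)|) := by gcongr; linarith
    rw [hx]; nlinarith
  have hbLN : (b : ℝ) * L * N' ≤ x := by
    have : (b : ℝ) * L * N' * 1 ≤ (b : ℝ) * M * N' * (1 + |(k : ℝ)|) := by gcongr; linarith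
    rw [hx]; linarith
  have hbLN1 : (1 : ℝ) ≤ (b : ℝ) * L * N' := by
    have h := mul_le_mul hbN1 hL1 zero_le_one (by positivity : (0 : ℝ) ≤ (b : ℝ) * N')
    calc (1 : ℝ) = 1 * 1 := by ring
      _ ≤ (b : ℝ) * N' * L := h
      _ = (b : ℝ) * L * N' := by ring
  have hbN'x : 2 * ((b : ℝ) * N') ≤ 2 * x := by
    have : (b : ℝ) * N' * (1 / 2) * 2 ≤ (b : ℝ) * N' * M * (1 + |(k : ℝ)|) := by gcongr; linarith
    rw [hx]; nlinarith
  -- the divisor parameter `T`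
  set T : ℝ := C₁ * (2 * ((b : ℝ) * N')) ^ δ with hT
  have hT1 : 1 ≤ T := by
    have : (1 : ℝ) ≤ (2 * ((b : ℝ) * N')) ^ δ := Real.one_le_rpow (by linarith) hδ.le
    rw [hT]; nlinarith
  have hT0 : 0 ≤ T := by linarith
  have hxδ1 : 1 ≤ x ^ δ := Real.one_le_rpow hx1 hδ.le
  have h2δ : (2 : ℝ) ^ δ ≤ 2 := by
    calc (2 : ℝ) ^ δ ≤ 2 ^ (1 : ℝ) := Real.rpow_le_rpow_of_exponent_le (by norm_num) hδ1
      _ = 2 := Real.rpow_one 2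
  have h4δ : (4 : ℝ) ^ δ ≤ 4 := by
    calc (4 : ℝ) ^ δ ≤ 4 ^ (1 : ℝ) := Real.rpow_le_rpow_of_exponent_le (by norm_num) hδ1
      _ = 4 := Real.rpow_one 4
  have hTx : T ≤ 2 * C₁ * x ^ δ := by
    have h1 : (2 * ((b : ℝ) * N')) ^ δ ≤ (2 * x) ^ δ := Real.rpow_le_rpow (by positivity) hbN'x hδ.le
    rw [Real.mul_rpow (by norm_num) hx0.le] at h1
    have h2 : (2 : ℝ) ^ δ * x ^ δ ≤ 2 * x ^ δ := by gcongr
    rw [hT]; nlinarith [h1.trans h2, show (0:ℝ) ≤ C₁ by linarith]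
  -- hypotheses of `kfd_diag_bound`
  have h𝓛 : ∀ ℓ ∈ 𝓛, ℓ.Prime ∧ L < ℓ ∧ ℓ ≤ 2 * L ∧ ℓ.Coprime k.natAbs := by
    intro ℓ hℓ
    rw [h𝓛def, Finset.mem_filter, Finset.mem_Ioc] at hℓ
    exact ⟨hℓ.2.1, hℓ.1.1, hℓ.1.2, hℓ.2.2.2⟩
  have hγ' : ∀ n, γ n ≠ 0 → N' < n ∧ n.Coprime k.natAbs ∧ (((b * n).divisors.card : ℕ) : ℝ) ≤ T := by
    intro n hn
    obtain ⟨hn1, hn2⟩ := hγ n hn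
    refine ⟨hn1, hγk n hn, ?_⟩
    have hn0 : n ≠ 0 := by rintro rfl; simp at hn1; linarith
    have hbn0 : b * n ≠ 0 := Nat.mul_ne_zero hb.ne' hn0
    refine (hτ (b * n) hbn0).trans ?_
    rw [hT]
    refine mul_le_mul_of_nonneg_left (Real.rpow_le_rpow (by positivity) ?_ hδ.le) (by linarith)
    push_cast; nlinarith
  have hkb : k.natAbs.Coprime b := hbk.symm
  have hM12 : ⌊M⌋₊ ≤ ⌊2 * M⌋₊ := Nat.floor_le_floor (by linarith)
  have hd := kfd_diag_bound kfPhase (fun _ _ _ => rfl) k hb hL2 hkb 𝓛 h𝓛 hN0 γ hγ' hM12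
  -- rewrite its left side as `‖∑ kfDiag‖`
  have hD : ‖∑ m ∈ (Ioc ⌊M⌋₊ ⌊2 * M⌋₊).filter (fun m => m.Coprime b), kfDiag k b N' γ 𝓛 m‖ ≤
      S₂ * (𝓛.card * ((⌊2 * M⌋₊ : ℝ) - ⌊M⌋₊) + Real.log (2 * N') / Real.log L *
          (4 * T * ((⌊2 * M⌋₊ : ℝ) - ⌊M⌋₊) / (b * N') +
            16 * T ^ 2 * L * Real.sqrt (b * L * N') * (1 + Real.log (4 * (b * L * N'))))) := by
    unfold kfDiag kfTerm kfCoeff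
    exact hd
  clear hd
  -- scalar bounds
  have hcard : (𝓛.card : ℝ) ≤ L := by
    have : 𝓛.card ≤ (Ioc L (2 * L)).card := Finset.card_filter_le _ _
    rw [Nat.card_Ioc] at this
    have h' : 𝓛.card ≤ L := by omega
    exact_mod_cast h'
  have hdiff : ((⌊2 * M⌋₊ : ℝ) - ⌊M⌋₊) ≤ 3 * M := BC_floor_diff_le hM
  have hdiff0 : 0 ≤ ((⌊2 * M⌋₊ : ℝ) - ⌊M⌋₊) := by
    have : ((⌊M⌋₊ : ℕ) : ℝ) ≤ ⌊2 * M⌋₊ := by exact_mod_cast hM12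
    linarith
  have hR : Real.log (2 * N') / Real.log L ≤ 2 / δ * (2 * N') ^ δ :=
    BC_log_div_log_le hδ (by linarith) hLr
  have hR0 : 0 ≤ Real.log (2 * N') / Real.log L :=
    div_nonneg (Real.log_nonneg (by linarith)) (Real.log_nonneg hL1)
  have hRx : Real.log (2 * N') / Real.log L ≤ 4 / δ * x ^ δ := by
    have h1 : (2 * N') ^ δ ≤ (2 * x) ^ δ := Real.rpow_le_rpow (by positivity) hN'x hδ.le
    rw [Real.mul_rpow (by norm_num) hx0.le] at h1
    have h2 : (2:ℝ) ^ δ * x ^ δ ≤ 2 * x ^ δ := by gcongr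
    have hδ0 : 0 ≤ 2 / δ := by positivity
    calc Real.log (2 * N') / Real.log L ≤ 2 / δ * (2 * N') ^ δ := hR
      _ ≤ 2 / δ * (2 * x ^ δ) := mul_le_mul_of_nonneg_left (h1.trans h2) hδ0
      _ = 4 / δ * x ^ δ := by ring
  have hlog4 : 1 + Real.log (4 * ((b : ℝ) * L * N')) ≤ (1 + 1 / δ) * (4 * x ^ δ) := by
    have h1 : 1 + Real.log (4 * ((b : ℝ) * L * N')) ≤ (1 + 1 / δ) * (4 * ((b : ℝ) * L * N')) ^ δ :=
      BC_one_add_log_le hδ (by linarith only [hbLN1])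
    have h2 : (4 * ((b : ℝ) * L * N')) ^ δ ≤ (4 * x) ^ δ :=
      Real.rpow_le_rpow (by positivity) (by linarith) hδ.le
    rw [Real.mul_rpow (by norm_num) hx0.le] at h2
    have h3 : (4:ℝ) ^ δ * x ^ δ ≤ 4 * x ^ δ := by gcongr
    have h0 : 0 ≤ 1 + 1 / δ := by positivity
    exact h1.trans (mul_le_mul_of_nonneg_left (h2.trans h3) h0)
  have hlogL2 : Real.log L ^ 2 ≤ x ^ (2 * δ) / δ ^ 2 := by
    have h1 := BC_log_sq_le hδ hL1
    have h2 : (L : ℝ) ^ (2 * δ) ≤ x ^ (2 * δ) :=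
      Real.rpow_le_rpow hL0.le (hLM.trans hMx) (by linarith)
    exact h1.trans (div_le_div_of_nonneg_right h2 (by positivity))
  have hsqrt : Real.sqrt ((b : ℝ) * L * N') = ((b : ℝ) * N') ^ (1 / 2 : ℝ) * (L : ℝ) ^ (1 / 2 : ℝ) := by
    rw [Real.sqrt_eq_rpow, show (b : ℝ) * L * N' = ((b : ℝ) * N') * L by ring,
      Real.mul_rpow (by positivity) hL0.le]
  -- powers of `x`
  have hx2δ : x ^ (2 * δ) = x ^ δ * x ^ δ := by
    rw [show 2 * δ = δ + δ by ring, Real.rpow_add hx0]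
  have hx6δ : x ^ (6 * δ) = x ^ δ * x ^ δ * x ^ δ * x ^ δ * x ^ δ * x ^ δ := by
    rw [show 6 * δ = δ + δ + δ + δ + δ + δ by ring, Real.rpow_add hx0, Real.rpow_add hx0,
      Real.rpow_add hx0, Real.rpow_add hx0, Real.rpow_add hx0]
  have hxδ0 : 0 ≤ x ^ δ := by linarith
  -- the three pieces of the diagonal bound, each ≤ (const) x^{4δ} × (monomial without the M/L² factor)
  -- piece 1: `#𝓛 (M₂ - M₁) ≤ 3 L M`
  have hp1 : (𝓛.card : ℝ) * ((⌊2 * M⌋₊ : ℝ) - ⌊M⌋₊) ≤ 3 * L * M := by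
    calc (𝓛.card : ℝ) * ((⌊2 * M⌋₊ : ℝ) - ⌊M⌋₊) ≤ L * (3 * M) :=
          mul_le_mul hcard hdiff hdiff0 hL0.le
      _ = 3 * L * M := by ring
  -- piece 2: `R · 4T(M₂-M₁)/(bN') ≤ (96 C₁/δ) x^{2δ} M/(bN')`
  have hp2 : Real.log (2 * N') / Real.log L * (4 * T * ((⌊2 * M⌋₊ : ℝ) - ⌊M⌋₊) / (b * N')) ≤
      96 * C₁ / δ * (x ^ δ * x ^ δ) * (M / ((b : ℝ) * N')) := by
    have h1 : 4 * T * ((⌊2 * M⌋₊ : ℝ) - ⌊M⌋₊) / (b * N') ≤ 4 * (2 * C₁ * x ^ δ) * (3 * M) / (b * N') := by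
      gcongr
    have h1' : 0 ≤ 4 * T * ((⌊2 * M⌋₊ : ℝ) - ⌊M⌋₊) / (b * N') := by positivity
    calc Real.log (2 * N') / Real.log L * (4 * T * ((⌊2 * M⌋₊ : ℝ) - ⌊M⌋₊) / (b * N'))
        ≤ (4 / δ * x ^ δ) * (4 * (2 * C₁ * x ^ δ) * (3 * M) / (b * N')) :=
          mul_le_mul hRx h1 h1' (by positivity)
      _ = 96 * C₁ / δ * (x ^ δ * x ^ δ) * (M / ((b : ℝ) * N')) := by ring
  -- piece 3: `R · 16 T² L √(bLN') (1 + log(4bLN')) ≤ (1024 C₁² (1+1/δ)/δ) x^{4δ} L √(bLN')`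
  have hp3 : Real.log (2 * N') / Real.log L *
      (16 * T ^ 2 * L * Real.sqrt (b * L * N') * (1 + Real.log (4 * ((b : ℝ) * L * N')))) ≤
      1024 * C₁ ^ 2 * (1 + 1 / δ) / δ * (x ^ δ * x ^ δ * x ^ δ * x ^ δ) *
        ((L : ℝ) * Real.sqrt (b * L * N')) := by
    have hT2 : T ^ 2 ≤ (2 * C₁ * x ^ δ) ^ 2 := pow_le_pow_left₀ hT0 hTx 2
    have hs0 : 0 ≤ (L : ℝ) * Real.sqrt (b * L * N') := by positivity
    have h1 : 16 * T ^ 2 * L * Real.sqrt (b * L * N') * (1 + Real.log (4 * ((b : ℝ) * L * N'))) ≤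
        16 * (2 * C₁ * x ^ δ) ^ 2 * L * Real.sqrt (b * L * N') * ((1 + 1 / δ) * (4 * x ^ δ)) := by
      have hl0 : 0 ≤ 1 + Real.log (4 * ((b : ℝ) * L * N')) := by
        have : 0 ≤ Real.log (4 * ((b : ℝ) * L * N')) := Real.log_nonneg (by linarith only [hbLN1])
        linarith
      have ha : 16 * T ^ 2 * L * Real.sqrt (b * L * N') ≤
          16 * (2 * C₁ * x ^ δ) ^ 2 * L * Real.sqrt (b * L * N') := by gcongr
      exact mul_le_mul ha hlog4 hl0 (by positivity)
    have h1' : 0 ≤ 16 * T ^ 2 * L * Real.sqrt (b * L * N') * (1 + Real.log (4 * ((b : ℝ) * L * N'))) := by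
      have : 0 ≤ Real.log (4 * ((b : ℝ) * L * N')) := Real.log_nonneg (by linarith only [hbLN1])
      positivity
    calc Real.log (2 * N') / Real.log L *
          (16 * T ^ 2 * L * Real.sqrt (b * L * N') * (1 + Real.log (4 * ((b : ℝ) * L * N'))))
        ≤ (4 / δ * x ^ δ) *
          (16 * (2 * C₁ * x ^ δ) ^ 2 * L * Real.sqrt (b * L * N') * ((1 + 1 / δ) * (4 * x ^ δ))) :=
          mul_le_mul hRx h1 h1' (by positivity)
      _ = 1024 * C₁ ^ 2 * (1 + 1 / δ) / δ * (x ^ δ * x ^ δ * x ^ δ * x ^ δ) *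
          ((L : ℝ) * Real.sqrt (b * L * N')) := by ring
  -- combine the pieces: `‖∑ kfDiag‖ ≤ S₂ (p1 + p2 + p3)`
  have hD' : ‖∑ m ∈ (Ioc ⌊M⌋₊ ⌊2 * M⌋₊).filter (fun m => m.Coprime b), kfDiag k b N' γ 𝓛 m‖ ≤
      S₂ * (3 * L * M + 96 * C₁ / δ * (x ^ δ * x ^ δ) * (M / ((b : ℝ) * N')) +
        1024 * C₁ ^ 2 * (1 + 1 / δ) / δ * (x ^ δ * x ^ δ * x ^ δ * x ^ δ) *
          ((L : ℝ) * Real.sqrt (b * L * N'))) := by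
    refine hD.trans (mul_le_mul_of_nonneg_left ?_ hS0)
    rw [mul_add]
    linarith [hp1, hp2, hp3]
  -- multiply by the amplifier factor `32 M (log L)²/L² ≤ (32/δ²) x^{2δ} M/L²`
  have hF : 32 * M * Real.log L ^ 2 / (L : ℝ) ^ 2 ≤ 32 / δ ^ 2 * (x ^ δ * x ^ δ) * (M / (L : ℝ) ^ 2) := by
    rw [← hx2δ]
    have : 32 * M * Real.log L ^ 2 / (L : ℝ) ^ 2 = 32 * (M / (L : ℝ) ^ 2) * Real.log L ^ 2 := by ring
    rw [this]
    calc 32 * (M / (L : ℝ) ^ 2) * Real.log L ^ 2 ≤ 32 * (M / (L : ℝ) ^ 2) * (x ^ (2 * δ) / δ ^ 2) := by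
          gcongr
      _ = 32 / δ ^ 2 * x ^ (2 * δ) * (M / (L : ℝ) ^ 2) := by ring
  have hF0 : 0 ≤ 32 * M * Real.log L ^ 2 / (L : ℝ) ^ 2 := by positivity
  have hnorm0 : 0 ≤ ‖∑ m ∈ (Ioc ⌊M⌋₊ ⌊2 * M⌋₊).filter (fun m => m.Coprime b), kfDiag k b N' γ 𝓛 m‖ :=
    norm_nonneg _
  have hstep : 32 * M * Real.log L ^ 2 / (L : ℝ) ^ 2 *
      ‖∑ m ∈ (Ioc ⌊M⌋₊ ⌊2 * M⌋₊).filter (fun m => m.Coprime b), kfDiag k b N' γ 𝓛 m‖ ≤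
      (32 / δ ^ 2 * (x ^ δ * x ^ δ) * (M / (L : ℝ) ^ 2)) *
      (S₂ * (3 * L * M + 96 * C₁ / δ * (x ^ δ * x ^ δ) * (M / ((b : ℝ) * N')) +
        1024 * C₁ ^ 2 * (1 + 1 / δ) / δ * (x ^ δ * x ^ δ * x ^ δ * x ^ δ) *
          ((L : ℝ) * Real.sqrt (b * L * N')))) :=
    mul_le_mul hF hD' hnorm0 (by positivity)
  refine hstep.trans ?_
  -- algebra: identify the monomials
  have hm1 : M / (L : ℝ) ^ 2 * (3 * L * M) = 3 * (M ^ 2 / L) := by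
    field_simp
  have hm2 : M / (L : ℝ) ^ 2 * (M / ((b : ℝ) * N')) ≤ M ^ 2 / ((b : ℝ) * L * N') := by
    rw [div_mul_div_comm, show M * M = M ^ 2 by ring]
    apply div_le_div_of_nonneg_left (by positivity) (by positivity)
    have hLL : (L : ℝ) ≤ (L : ℝ) ^ 2 := by nlinarith only [hL1]
    have h := mul_le_mul_of_nonneg_left hLL (le_of_lt (mul_pos hb0 hN0))
    calc (b : ℝ) * L * N' = (b : ℝ) * N' * L := by ring
      _ ≤ (b : ℝ) * N' * (L : ℝ) ^ 2 := h
      _ = (L : ℝ) ^ 2 * ((b : ℝ) * N') := by ring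
  have hm3 : M / (L : ℝ) ^ 2 * ((L : ℝ) * Real.sqrt (b * L * N')) =
      M * ((b : ℝ) * N') ^ (1 / 2 : ℝ) * (L : ℝ) ^ (-(1 / 2) : ℝ) := by
    rw [hsqrt]
    have hL12 : (L : ℝ) ^ (-(1 / 2) : ℝ) = (L : ℝ) ^ (1 / 2 : ℝ) / L := by
      rw [show (-(1 / 2) : ℝ) = 1 / 2 - 1 by norm_num, Real.rpow_sub_one hL0.ne']
    rw [hL12]
    field_simp
  -- final estimate
  set P₁ := M ^ 2 / (L : ℝ) with hP₁
  set P₂ := M ^ 2 / ((b : ℝ) * L * N') with hP₂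
  set P₃ := M * ((b : ℝ) * N') ^ (1 / 2 : ℝ) * (L : ℝ) ^ (-(1 / 2) : ℝ) with hP₃
  have hP₁0 : 0 ≤ P₁ := by positivity
  have hP₂0 : 0 ≤ P₂ := by positivity
  have hP₃0 : 0 ≤ P₃ := by positivity
  set y := x ^ δ with hy
  have hy1 : 1 ≤ y := hxδ1
  have hy0 : 0 ≤ y := by linarith
  have hC0 : 0 ≤ C₁ := by linarith
  have hδi : 1 ≤ 1 / δ := by rw [le_div_iff₀ hδ]; linarith
  -- expand the left side
  have hexp : (32 / δ ^ 2 * (y * y) * (M / (L : ℝ) ^ 2)) *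
      (S₂ * (3 * L * M + 96 * C₁ / δ * (y * y) * (M / ((b : ℝ) * N')) +
        1024 * C₁ ^ 2 * (1 + 1 / δ) / δ * (y * y * y * y) * ((L : ℝ) * Real.sqrt (b * L * N')))) =
      S₂ * (32 / δ ^ 2 * (y * y) * (M / (L : ℝ) ^ 2 * (3 * L * M)) +
        3072 * C₁ / δ ^ 3 * (y * y * y * y) * (M / (L : ℝ) ^ 2 * (M / ((b : ℝ) * N'))) +
        32768 * C₁ ^ 2 * (1 + 1 / δ) / δ ^ 3 * (y * y * y * y * y * y) *
          (M / (L : ℝ) ^ 2 * ((L : ℝ) * Real.sqrt (b * L * N')))) := by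
    field_simp
    ring
  rw [hexp, hm1, hm3, hx6δ]
  -- powers of `y ≥ 1`
  have step : ∀ a : ℝ, 0 ≤ a → a ≤ a * y := fun a ha => le_mul_of_one_le_right ha hy1
  have hy2 : y * y ≤ y * y * y * y * y * y :=
    (step _ (by positivity)).trans ((step _ (by positivity)).trans
      ((step _ (by positivity)).trans (step _ (by positivity))))
  have hy4 : y * y * y * y ≤ y * y * y * y * y * y :=
    (step _ (by positivity)).trans (step _ (by positivity))
  set z := y * y * y * y * y * y with hz
  have hz0 : 0 ≤ z := by positivity
  -- termwise
  have t1 : 32 / δ ^ 2 * (y * y) * (3 * P₁) ≤ 96 / δ ^ 3 * z * P₁ := by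
    have e1 : 32 / δ ^ 2 * (y * y) * (3 * P₁) = 96 / δ ^ 2 * (y * y) * P₁ := by ring
    rw [e1]
    have hδ23 : 96 / δ ^ 2 ≤ 96 / δ ^ 3 := by
      apply div_le_div_of_nonneg_left (by norm_num) (by positivity)
      have : δ ^ 2 * δ ≤ δ ^ 2 * 1 := mul_le_mul_of_nonneg_left hδ1 (by positivity)
      calc δ ^ 3 = δ ^ 2 * δ := by ring
        _ ≤ δ ^ 2 * 1 := this
        _ = δ ^ 2 := by ring
    apply mul_le_mul_of_nonneg_right _ hP₁0
    exact mul_le_mul hδ23 hy2 (by positivity) (by positivity)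
  have t2 : 3072 * C₁ / δ ^ 3 * (y * y * y * y) * (M / (L : ℝ) ^ 2 * (M / ((b : ℝ) * N'))) ≤
      3072 * C₁ / δ ^ 3 * z * P₂ :=
    mul_le_mul (mul_le_mul_of_nonneg_left hy4 (by positivity)) hm2 (by positivity) (by positivity)
  -- constants
  have hC2 : 1 ≤ C₁ ^ 2 := by nlinarith only [hC₁]
  have h1δ : 1 ≤ 1 + 1 / δ := by linarith only [hδi]
  have hbig : (40000 : ℝ) ≤ 40000 * C₁ ^ 2 * (1 + 1 / δ) := by
    have := mul_le_mul hC2 h1δ zero_le_one (by positivity)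
    linarith only [this]
  have hc1 : 96 / δ ^ 3 ≤ 40000 * C₁ ^ 2 * (1 + 1 / δ) / δ ^ 3 := by
    apply div_le_div_of_nonneg_right _ (by positivity)
    linarith only [hbig]
  have hc2 : 3072 * C₁ / δ ^ 3 ≤ 40000 * C₁ ^ 2 * (1 + 1 / δ) / δ ^ 3 := by
    apply div_le_div_of_nonneg_right _ (by positivity)
    have hCC : C₁ ≤ C₁ ^ 2 := by nlinarith only [hC₁]
    have h2 : C₁ ^ 2 ≤ C₁ ^ 2 * (1 + 1 / δ) := le_mul_of_one_le_right (by positivity) h1δ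
    linarith only [hCC, h2, hC0]
  have hc3 : 32768 * C₁ ^ 2 * (1 + 1 / δ) / δ ^ 3 ≤ 40000 * C₁ ^ 2 * (1 + 1 / δ) / δ ^ 3 := by
    apply div_le_div_of_nonneg_right _ (by positivity)
    have : 0 ≤ C₁ ^ 2 * (1 + 1 / δ) := by positivity
    linarith only [this]
  have a1 := mul_le_mul_of_nonneg_right (mul_le_mul_of_nonneg_right hc1 hz0) hP₁0
  have a2 := mul_le_mul_of_nonneg_right (mul_le_mul_of_nonneg_right hc2 hz0) hP₂0
  have a3 := mul_le_mul_of_nonneg_right (mul_le_mul_of_nonneg_right hc3 hz0) hP₃0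
  have hsum : 32 / δ ^ 2 * (y * y) * (3 * P₁) +
      3072 * C₁ / δ ^ 3 * (y * y * y * y) * (M / (L : ℝ) ^ 2 * (M / ((b : ℝ) * N'))) +
      32768 * C₁ ^ 2 * (1 + 1 / δ) / δ ^ 3 * z * P₃ ≤
      40000 * C₁ ^ 2 * (1 + 1 / δ) / δ ^ 3 * z * (P₃ + P₂ + P₁) := by
    have e : 40000 * C₁ ^ 2 * (1 + 1 / δ) / δ ^ 3 * z * (P₃ + P₂ + P₁) =
        40000 * C₁ ^ 2 * (1 + 1 / δ) / δ ^ 3 * z * P₁ + 40000 * C₁ ^ 2 * (1 + 1 / δ) / δ ^ 3 * z * P₂ +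
          40000 * C₁ ^ 2 * (1 + 1 / δ) / δ ^ 3 * z * P₃ := by ring
    rw [e]
    linarith only [t1, t2, a1, a2, a3]
  calc S₂ * (32 / δ ^ 2 * (y * y) * (3 * P₁) +
        3072 * C₁ / δ ^ 3 * (y * y * y * y) * (M / (L : ℝ) ^ 2 * (M / ((b : ℝ) * N'))) +
        32768 * C₁ ^ 2 * (1 + 1 / δ) / δ ^ 3 * z * P₃)
      ≤ S₂ * (40000 * C₁ ^ 2 * (1 + 1 / δ) / δ ^ 3 * z * (P₃ + P₂ + P₁)) :=
        mul_le_mul_of_nonneg_left hsum hS0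
    _ = 40000 * C₁ ^ 2 * (1 + 1 / δ) / δ ^ 3 * S₂ * z * (P₃ + P₂ + P₁) := by ring

/-! ### The off-diagonal contribution in the shape (5.1) -/

/-- **The off-diagonal terms in the shape of (5.1)** (Bettin–Chandee (4.33) × the amplifier factor
`M L^{-2+ε}`): for `2 ≤ L ≤ M`, `1 ≤ N'`, `k ≠ 0` (so that `L ≤ x = bMN'(1+|k|)`),
`(32 M (log L)²/L²) · K S₂ x^{ε'} W L (b^{3/4}N'^{5/4}L^{1/2}M^{-1/2} + b^{1/2}L^{5/2}N'^{7/4}/M + b^{1/2}N')`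
`≤ (32K/δ²) S₂ x^{ε'+2δ} W (b^{3/4}M^{1/2}N'^{5/4}L^{-1/2} + b^{1/2}L^{3/2}N'^{7/4} + b^{1/2}MN'/L)`.
[cite: BettinChandee2018, §4 (4.33), §5 (5.1)] -/
theorem BC_off_51 {δ : ℝ} (hδ : 0 < δ) {b : ℕ} (hb : 0 < b) {M N' : ℝ} (hM : 1 / 2 ≤ M)
    (hN1 : 1 ≤ N') {k : ℤ} (hk : k ≠ 0) {L : ℕ} (hL2 : 2 ≤ L) (hLM : (L : ℝ) ≤ M)
    {K S₂ W : ℝ} (ε' : ℝ) (hK : 0 ≤ K) (hS : 0 ≤ S₂) (hW : 0 ≤ W) :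
    32 * M * Real.log L ^ 2 / (L : ℝ) ^ 2 *
      (K * S₂ * ((b : ℝ) * M * N' * (1 + |(k : ℝ)|)) ^ ε' * W * (L : ℝ) *
        ((b : ℝ) ^ (3 / 4 : ℝ) * N' ^ (5 / 4 : ℝ) * (L : ℝ) ^ (1 / 2 : ℝ) * M ^ (-(1 / 2) : ℝ) +
          (b : ℝ) ^ (1 / 2 : ℝ) * (L : ℝ) ^ (5 / 2 : ℝ) * N' ^ (7 / 4 : ℝ) * M⁻¹ +
          (b : ℝ) ^ (1 / 2 : ℝ) * N')) ≤
      32 * K / δ ^ 2 * S₂ * ((b : ℝ) * M * N' * (1 + |(k : ℝ)|)) ^ (ε' + 2 * δ) * W *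
        ((b : ℝ) ^ (3 / 4 : ℝ) * M ^ (1 / 2 : ℝ) * N' ^ (5 / 4 : ℝ) * (L : ℝ) ^ (-(1 / 2) : ℝ) +
          (b : ℝ) ^ (1 / 2 : ℝ) * (L : ℝ) ^ (3 / 2 : ℝ) * N' ^ (7 / 4 : ℝ) +
          (b : ℝ) ^ (1 / 2 : ℝ) * M * N' / L) := by
  set x : ℝ := (b : ℝ) * M * N' * (1 + |(k : ℝ)|) with hx
  have hbr : (1 : ℝ) ≤ b := by exact_mod_cast hb
  have hM0 : 0 < M := by linarith
  have hN0 : 0 < N' := by linarith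
  have hk1 : (1 : ℝ) ≤ |(k : ℝ)| := by
    rw [← Int.cast_abs]; exact_mod_cast Int.one_le_abs hk
  have hLr : (2 : ℝ) ≤ L := by exact_mod_cast hL2
  have hL0 : (0 : ℝ) < L := by linarith
  have hL1 : (1 : ℝ) ≤ L := by linarith
  have hbN1 : (1 : ℝ) ≤ b * N' := by nlinarith
  have hMx : M ≤ x := by
    have : M * 1 * 2 ≤ M * ((b : ℝ) * N') * (1 + |(k : ℝ)|) := by gcongr; linarith
    rw [hx]; nlinarith
  have hx0 : 0 < x := by linarith
  -- `(log L)² ≤ x^{2δ}/δ²`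
  have hlogL2 : Real.log L ^ 2 ≤ x ^ (2 * δ) / δ ^ 2 := by
    have h1 := BC_log_sq_le hδ hL1
    have h2 : (L : ℝ) ^ (2 * δ) ≤ x ^ (2 * δ) :=
      Real.rpow_le_rpow hL0.le (hLM.trans hMx) (by linarith)
    exact h1.trans (div_le_div_of_nonneg_right h2 (by positivity))
  -- the monomial identities
  have hM12 : M * M ^ (-(1 / 2) : ℝ) = M ^ (1 / 2 : ℝ) := by
    rw [show (-(1 / 2) : ℝ) = 1 / 2 - 1 by norm_num, Real.rpow_sub_one hM0.ne']
    field_simp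
  have hL12 : (L : ℝ) ^ (1 / 2 : ℝ) / L = (L : ℝ) ^ (-(1 / 2) : ℝ) := by
    rw [show (-(1 / 2) : ℝ) = 1 / 2 - 1 by norm_num, Real.rpow_sub_one hL0.ne']
  have hL52 : (L : ℝ) ^ (5 / 2 : ℝ) / L = (L : ℝ) ^ (3 / 2 : ℝ) := by
    rw [show (3 / 2 : ℝ) = 5 / 2 - 1 by norm_num, Real.rpow_sub_one hL0.ne']
  have hid : M / (L : ℝ) *
      ((b : ℝ) ^ (3 / 4 : ℝ) * N' ^ (5 / 4 : ℝ) * (L : ℝ) ^ (1 / 2 : ℝ) * M ^ (-(1 / 2) : ℝ) +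
        (b : ℝ) ^ (1 / 2 : ℝ) * (L : ℝ) ^ (5 / 2 : ℝ) * N' ^ (7 / 4 : ℝ) * M⁻¹ +
        (b : ℝ) ^ (1 / 2 : ℝ) * N') =
      (b : ℝ) ^ (3 / 4 : ℝ) * M ^ (1 / 2 : ℝ) * N' ^ (5 / 4 : ℝ) * (L : ℝ) ^ (-(1 / 2) : ℝ) +
        (b : ℝ) ^ (1 / 2 : ℝ) * (L : ℝ) ^ (3 / 2 : ℝ) * N' ^ (7 / 4 : ℝ) +
        (b : ℝ) ^ (1 / 2 : ℝ) * M * N' / L := by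
    rw [← hM12, ← hL12, ← hL52]
    field_simp
  -- assemble
  set Q := (b : ℝ) ^ (3 / 4 : ℝ) * N' ^ (5 / 4 : ℝ) * (L : ℝ) ^ (1 / 2 : ℝ) * M ^ (-(1 / 2) : ℝ) +
        (b : ℝ) ^ (1 / 2 : ℝ) * (L : ℝ) ^ (5 / 2 : ℝ) * N' ^ (7 / 4 : ℝ) * M⁻¹ +
        (b : ℝ) ^ (1 / 2 : ℝ) * N' with hQ
  have hQ0 : 0 ≤ Q := by positivity
  have hre : 32 * M * Real.log L ^ 2 / (L : ℝ) ^ 2 * (K * S₂ * x ^ ε' * W * (L : ℝ) * Q) =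
      32 * K * S₂ * x ^ ε' * W * Real.log L ^ 2 * (M / (L : ℝ) * Q) := by
    field_simp
  rw [hre, hid]
  set Q' := (b : ℝ) ^ (3 / 4 : ℝ) * M ^ (1 / 2 : ℝ) * N' ^ (5 / 4 : ℝ) * (L : ℝ) ^ (-(1 / 2) : ℝ) +
        (b : ℝ) ^ (1 / 2 : ℝ) * (L : ℝ) ^ (3 / 2 : ℝ) * N' ^ (7 / 4 : ℝ) +
        (b : ℝ) ^ (1 / 2 : ℝ) * M * N' / L with hQ'
  have hQ'0 : 0 ≤ Q' := by positivity
  have hxe : x ^ (ε' + 2 * δ) = x ^ ε' * x ^ (2 * δ) := Real.rpow_add hx0 _ _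
  rw [hxe]
  have h0 : 0 ≤ 32 * K * S₂ * x ^ ε' * W := by positivity
  calc 32 * K * S₂ * x ^ ε' * W * Real.log L ^ 2 * Q'
      ≤ 32 * K * S₂ * x ^ ε' * W * (x ^ (2 * δ) / δ ^ 2) * Q' :=
        mul_le_mul_of_nonneg_right (mul_le_mul_of_nonneg_left hlogL2 h0) hQ'0
    _ = 32 * K / δ ^ 2 * S₂ * (x ^ ε' * x ^ (2 * δ)) * W * Q' := by
        field_simp

/-! ### From `⌊L⌋₊` back to a real `L` -/

/-- For real `L ≥ 1` and `L₁ = ⌊L⌋₊` (so `L/2 ≤ L₁ ≤ L`), the six terms of (5.1) at `L₁` are at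
most twice those at `L`. [folklore] -/
theorem BC_terms51_floor_le {L : ℝ} (hL : 1 ≤ L) {b : ℕ} (hb : 0 < b) {M N' : ℝ} (hM : 0 < M)
    (hN : 0 < N') :
    M * ((b : ℝ) * N') ^ (1 / 2 : ℝ) * ((⌊L⌋₊ : ℕ) : ℝ) ^ (-(1 / 2) : ℝ) +
        M ^ 2 / ((b : ℝ) * ((⌊L⌋₊ : ℕ) : ℝ) * N') + M ^ 2 / ((⌊L⌋₊ : ℕ) : ℝ) +
        (b : ℝ) ^ (3 / 4 : ℝ) * M ^ (1 / 2 : ℝ) * N' ^ (5 / 4 : ℝ) * ((⌊L⌋₊ : ℕ) : ℝ) ^ (-(1 / 2) : ℝ) +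
        (b : ℝ) ^ (1 / 2 : ℝ) * ((⌊L⌋₊ : ℕ) : ℝ) ^ (3 / 2 : ℝ) * N' ^ (7 / 4 : ℝ) +
        (b : ℝ) ^ (1 / 2 : ℝ) * M * N' / ((⌊L⌋₊ : ℕ) : ℝ) ≤
    2 * (M * ((b : ℝ) * N') ^ (1 / 2 : ℝ) * L ^ (-(1 / 2) : ℝ) + M ^ 2 / ((b : ℝ) * L * N') +
        M ^ 2 / L +
        (b : ℝ) ^ (3 / 4 : ℝ) * M ^ (1 / 2 : ℝ) * N' ^ (5 / 4 : ℝ) * L ^ (-(1 / 2) : ℝ) +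
        (b : ℝ) ^ (1 / 2 : ℝ) * L ^ (3 / 2 : ℝ) * N' ^ (7 / 4 : ℝ) + (b : ℝ) ^ (1 / 2 : ℝ) * M * N' / L) := by
  set L₁ : ℝ := ((⌊L⌋₊ : ℕ) : ℝ) with hL₁
  have hb0 : (0 : ℝ) < b := by exact_mod_cast hb
  have hL0 : 0 < L := by linarith
  have h1 : L₁ ≤ L := Nat.floor_le hL0.le
  have h2 : L < L₁ + 1 := Nat.lt_floor_add_one L
  have h3 : (1 : ℝ) ≤ L₁ := by
    have : 1 ≤ ⌊L⌋₊ := (Nat.one_le_floor_iff _).mpr hL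
    rw [hL₁]; exact_mod_cast this
  have hL₁0 : 0 < L₁ := by linarith
  have h4 : L ≤ 2 * L₁ := by linarith
  -- reciprocal and power comparisons
  have hinv : 1 / L₁ ≤ 2 / L := by
    rw [div_le_div_iff₀ hL₁0 hL0]; linarith
  have hm12 : L₁ ^ (-(1 / 2) : ℝ) ≤ 2 * L ^ (-(1 / 2) : ℝ) := by
    have ha : L₁ ^ (-(1 / 2) : ℝ) ≤ (L / 2) ^ (-(1 / 2) : ℝ) :=
      Real.rpow_le_rpow_of_nonpos (by positivity) (by linarith) (by norm_num)
    have hb' : (L / 2) ^ (-(1 / 2) : ℝ) = (1 / 2) ^ (-(1 / 2) : ℝ) * L ^ (-(1 / 2) : ℝ) := by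
      rw [show L / 2 = (1 / 2) * L by ring, Real.mul_rpow (by norm_num) hL0.le]
    have hc : (1 / 2 : ℝ) ^ (-(1 / 2) : ℝ) ≤ 2 := by
      rw [Real.rpow_neg (by norm_num), ← Real.inv_rpow (by norm_num)]
      norm_num
      calc (2 : ℝ) ^ (1 / 2 : ℝ) ≤ 2 ^ (1 : ℝ) :=
            Real.rpow_le_rpow_of_exponent_le (by norm_num) (by norm_num)
        _ = 2 := Real.rpow_one 2
    have hL12 : 0 ≤ L ^ (-(1 / 2) : ℝ) := Real.rpow_nonneg hL0.le _
    calc L₁ ^ (-(1 / 2) : ℝ) ≤ (1 / 2) ^ (-(1 / 2) : ℝ) * L ^ (-(1 / 2) : ℝ) := ha.trans (le_of_eq hb')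
      _ ≤ 2 * L ^ (-(1 / 2) : ℝ) := mul_le_mul_of_nonneg_right hc hL12
  have h32 : L₁ ^ (3 / 2 : ℝ) ≤ L ^ (3 / 2 : ℝ) := Real.rpow_le_rpow hL₁0.le h1 (by norm_num)
  -- termwise
  have t1 : M * ((b : ℝ) * N') ^ (1 / 2 : ℝ) * L₁ ^ (-(1 / 2) : ℝ) ≤
      2 * (M * ((b : ℝ) * N') ^ (1 / 2 : ℝ) * L ^ (-(1 / 2) : ℝ)) := by
    have h0 : 0 ≤ M * ((b : ℝ) * N') ^ (1 / 2 : ℝ) := by positivity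
    calc M * ((b : ℝ) * N') ^ (1 / 2 : ℝ) * L₁ ^ (-(1 / 2) : ℝ)
        ≤ M * ((b : ℝ) * N') ^ (1 / 2 : ℝ) * (2 * L ^ (-(1 / 2) : ℝ)) := mul_le_mul_of_nonneg_left hm12 h0
      _ = 2 * (M * ((b : ℝ) * N') ^ (1 / 2 : ℝ) * L ^ (-(1 / 2) : ℝ)) := by ring
  have t2 : M ^ 2 / ((b : ℝ) * L₁ * N') ≤ 2 * (M ^ 2 / ((b : ℝ) * L * N')) := by
    have e1 : M ^ 2 / ((b : ℝ) * L₁ * N') = M ^ 2 / ((b : ℝ) * N') * (1 / L₁) := by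
      field_simp
    have e2 : 2 * (M ^ 2 / ((b : ℝ) * L * N')) = M ^ 2 / ((b : ℝ) * N') * (2 / L) := by
      field_simp
    rw [e1, e2]
    exact mul_le_mul_of_nonneg_left hinv (by positivity)
  have t3 : M ^ 2 / L₁ ≤ 2 * (M ^ 2 / L) := by
    have e1 : M ^ 2 / L₁ = M ^ 2 * (1 / L₁) := by field_simp
    have e2 : 2 * (M ^ 2 / L) = M ^ 2 * (2 / L) := by field_simp
    rw [e1, e2]
    exact mul_le_mul_of_nonneg_left hinv (by positivity)
  have t4 : (b : ℝ) ^ (3 / 4 : ℝ) * M ^ (1 / 2 : ℝ) * N' ^ (5 / 4 : ℝ) * L₁ ^ (-(1 / 2) : ℝ) ≤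
      2 * ((b : ℝ) ^ (3 / 4 : ℝ) * M ^ (1 / 2 : ℝ) * N' ^ (5 / 4 : ℝ) * L ^ (-(1 / 2) : ℝ)) := by
    have h0 : 0 ≤ (b : ℝ) ^ (3 / 4 : ℝ) * M ^ (1 / 2 : ℝ) * N' ^ (5 / 4 : ℝ) := by positivity
    calc (b : ℝ) ^ (3 / 4 : ℝ) * M ^ (1 / 2 : ℝ) * N' ^ (5 / 4 : ℝ) * L₁ ^ (-(1 / 2) : ℝ)
        ≤ (b : ℝ) ^ (3 / 4 : ℝ) * M ^ (1 / 2 : ℝ) * N' ^ (5 / 4 : ℝ) * (2 * L ^ (-(1 / 2) : ℝ)) :=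
          mul_le_mul_of_nonneg_left hm12 h0
      _ = 2 * ((b : ℝ) ^ (3 / 4 : ℝ) * M ^ (1 / 2 : ℝ) * N' ^ (5 / 4 : ℝ) * L ^ (-(1 / 2) : ℝ)) := by ring
  have t5 : (b : ℝ) ^ (1 / 2 : ℝ) * L₁ ^ (3 / 2 : ℝ) * N' ^ (7 / 4 : ℝ) ≤
      2 * ((b : ℝ) ^ (1 / 2 : ℝ) * L ^ (3 / 2 : ℝ) * N' ^ (7 / 4 : ℝ)) := by
    have h0 : 0 ≤ (b : ℝ) ^ (1 / 2 : ℝ) := by positivity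
    have h0' : 0 ≤ N' ^ (7 / 4 : ℝ) := by positivity
    have a : (b : ℝ) ^ (1 / 2 : ℝ) * L₁ ^ (3 / 2 : ℝ) * N' ^ (7 / 4 : ℝ) ≤
        (b : ℝ) ^ (1 / 2 : ℝ) * L ^ (3 / 2 : ℝ) * N' ^ (7 / 4 : ℝ) :=
      mul_le_mul_of_nonneg_right (mul_le_mul_of_nonneg_left h32 h0) h0'
    have hnn : 0 ≤ (b : ℝ) ^ (1 / 2 : ℝ) * L ^ (3 / 2 : ℝ) * N' ^ (7 / 4 : ℝ) := by positivity
    linarith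
  have t6 : (b : ℝ) ^ (1 / 2 : ℝ) * M * N' / L₁ ≤ 2 * ((b : ℝ) ^ (1 / 2 : ℝ) * M * N' / L) := by
    have e1 : (b : ℝ) ^ (1 / 2 : ℝ) * M * N' / L₁ = (b : ℝ) ^ (1 / 2 : ℝ) * M * N' * (1 / L₁) := by
      field_simp
    have e2 : 2 * ((b : ℝ) ^ (1 / 2 : ℝ) * M * N' / L) = (b : ℝ) ^ (1 / 2 : ℝ) * M * N' * (2 / L) := by
      field_simp
    rw [e1, e2]
    exact mul_le_mul_of_nonneg_left hinv (by positivity)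
  linarith [t1, t2, t3, t4, t5, t6]

/-! ### Two small inequalities used in the assembly -/

/-- `b |k| m ≤ 2 bMN'(1+|k|)` for `m ≤ 2M`, `N' ≥ 1`. [folklore] -/
theorem BC_bkm_le_two_x {b m : ℕ} {k : ℤ} {M N' : ℝ} (hN1 : 1 ≤ N') (hm : (m : ℝ) ≤ 2 * M) :
    ((b * k.natAbs * m : ℕ) : ℝ) ≤ 2 * ((b : ℝ) * M * N' * (1 + |(k : ℝ)|)) := by
  have hkabs : ((k.natAbs : ℕ) : ℝ) = |(k : ℝ)| := by rw [Nat.cast_natAbs, Int.cast_abs]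
  push_cast
  rw [hkabs]
  have hb0 : (0 : ℝ) ≤ b := Nat.cast_nonneg _
  have hk0 : 0 ≤ |(k : ℝ)| := abs_nonneg _
  have hM0 : 0 ≤ 2 * M := le_trans (Nat.cast_nonneg _) hm
  have h1 : (b : ℝ) * |(k : ℝ)| * m ≤ (b : ℝ) * |(k : ℝ)| * (2 * M) :=
    mul_le_mul_of_nonneg_left hm (by positivity)
  have h3 : |(k : ℝ)| ≤ (1 + |(k : ℝ)|) * N' := by nlinarith
  have h4 : (b : ℝ) * |(k : ℝ)| * (2 * M) ≤ (b : ℝ) * ((1 + |(k : ℝ)|) * N') * (2 * M) :=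
    mul_le_mul_of_nonneg_right (mul_le_mul_of_nonneg_left h3 hb0) hM0
  calc (b : ℝ) * |(k : ℝ)| * m ≤ (b : ℝ) * ((1 + |(k : ℝ)|) * N') * (2 * M) := h1.trans h4
    _ = 2 * ((b : ℝ) * M * N' * (1 + |(k : ℝ)|)) := by ring

/-- For `L ≥ max(1, M)`, `N' ≥ 1`, `b ≥ 1`: `MN' ≤ b^{1/2} L^{3/2} N'^{7/4} ≤` the six terms of (5.1)
(so that (5.1) is trivial in the range `L > M`). [folklore] -/
theorem BC_MN_le_terms51 {b : ℕ} (hb : 0 < b) {M N' L : ℝ} (hM : 0 < M) (hN1 : 1 ≤ N') (hL1 : 1 ≤ L)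
    (hML : M ≤ L) :
    M * N' ≤ M * ((b : ℝ) * N') ^ (1 / 2 : ℝ) * L ^ (-(1 / 2) : ℝ) + M ^ 2 / ((b : ℝ) * L * N') +
        M ^ 2 / L + (b : ℝ) ^ (3 / 4 : ℝ) * M ^ (1 / 2 : ℝ) * N' ^ (5 / 4 : ℝ) * L ^ (-(1 / 2) : ℝ) +
        (b : ℝ) ^ (1 / 2 : ℝ) * L ^ (3 / 2 : ℝ) * N' ^ (7 / 4 : ℝ) + (b : ℝ) ^ (1 / 2 : ℝ) * M * N' / L := by
  have hbr : (1 : ℝ) ≤ b := by exact_mod_cast hb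
  have hN0 : 0 < N' := by linarith
  have hL0 : 0 < L := by linarith
  have e1 : (1 : ℝ) ≤ (b : ℝ) ^ (1 / 2 : ℝ) := Real.one_le_rpow hbr (by norm_num)
  have e2 : M ≤ L ^ (3 / 2 : ℝ) := by
    calc M ≤ L := hML
      _ = L ^ (1 : ℝ) := (Real.rpow_one L).symm
      _ ≤ L ^ (3 / 2 : ℝ) := Real.rpow_le_rpow_of_exponent_le hL1 (by norm_num)
  have e3 : N' ≤ N' ^ (7 / 4 : ℝ) := by
    calc N' = N' ^ (1 : ℝ) := (Real.rpow_one N').symm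
      _ ≤ N' ^ (7 / 4 : ℝ) := Real.rpow_le_rpow_of_exponent_le hN1 (by norm_num)
  have e4 : M * N' ≤ L ^ (3 / 2 : ℝ) * N' ^ (7 / 4 : ℝ) := mul_le_mul e2 e3 hN0.le (by positivity)
  have e5 : M * N' ≤ (b : ℝ) ^ (1 / 2 : ℝ) * L ^ (3 / 2 : ℝ) * N' ^ (7 / 4 : ℝ) := by
    calc M * N' ≤ 1 * (L ^ (3 / 2 : ℝ) * N' ^ (7 / 4 : ℝ)) := by rw [one_mul]; exact e4
      _ ≤ (b : ℝ) ^ (1 / 2 : ℝ) * (L ^ (3 / 2 : ℝ) * N' ^ (7 / 4 : ℝ)) :=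
          mul_le_mul_of_nonneg_right e1 (by positivity)
      _ = (b : ℝ) ^ (1 / 2 : ℝ) * L ^ (3 / 2 : ℝ) * N' ^ (7 / 4 : ℝ) := by ring
  have a1 : 0 ≤ M * ((b : ℝ) * N') ^ (1 / 2 : ℝ) * L ^ (-(1 / 2) : ℝ) := by positivity
  have a2 : 0 ≤ M ^ 2 / ((b : ℝ) * L * N') := by positivity
  have a3 : 0 ≤ M ^ 2 / L := by positivity
  have a4 : 0 ≤ (b : ℝ) ^ (3 / 4 : ℝ) * M ^ (1 / 2 : ℝ) * N' ^ (5 / 4 : ℝ) * L ^ (-(1 / 2) : ℝ) := by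
    positivity
  have a6 : 0 ≤ (b : ℝ) ^ (1 / 2 : ℝ) * M * N' / L := by positivity
  linarith

end Literature.NumberTheory.LFunctions

end
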